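import Summits.HodgeConjecture.CorCM.IrreducibleOddWeightsIsotypicFrobeniusMultiplicity
import HarnessLib

/-!
# Isotypic cells, Frobenius III: THE MULTIPLICITY OF A REFERENCE IRREDUCIBLE IN THE PERMUTATION MODULE OF A
# TRANSITIVE SLOT IS `dim A_c^{H}/δ_c` — `m_c·δ_c = dim A_c^{Stab(x₀)}`

COR-CM (cell `pub-hodgecm2`, binder seat `b16` gen 77, count-neutral claim FROBENIUS RECIPROCITY IN THE REFERENCE
CURRENCY — MULTIPLICITIES FROM FIXED POINTS, file R3 — abstract `G`-set level, joins R1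
`CorCM/IrreducibleOddWeightsIsotypicFrobenius` (`dim Hom_G(ℚ^{Y₀}, A) = dim A^{Stab(x₀)}`) and R2
`…IsotypicFrobeniusMultiplicity` (`dim Hom_G(ℚ^{Y₀}, A_{c₀}) = |J_{c₀}|·δ_{c₀}`); theorems only, no definition, no
named fact, no `sorry`).  NEW as stated, hence under `Summits/`.  HONEST FRAMING: finite-dimensional linear algebra (the rational form of Frobenius
reciprocity for permutation modules, Lange–Rodríguez Lemma 2.8.1 «`ρ_H = ⊕_j (dim V_j^H / s_j)·W_j`», in the
unbundled reference currency of gen 72–76: no characters, no finiteness of `G`, the Schur index absorbed in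
`δ_c = dim_ℚ End_G(A_c)`); it makes the multiplicities `m_{i,c}` of gen 76 E3/E5 COMPUTABLE from the reference
`A_c` and the stabiliser alone — closing HONEST OPEN (iii) of the gen 76 card; nothing about Hodge classes is
asserted, `HC_CM` is neither used nor asserted.

SETTING (gen 75 M-series / gen 76 E-series hypotheses, ONE slot).  `Y₀` a finite `G`-set with a point `x₀`,
transitive (`∀ x ∃ g, g·x₀ = x`); references `A_c ≤ ℚ^{Y_c}` (`c ∈ C`) stable irreducible pairwise
non-embeddable (`hRst`, `hRirr`, `hsep`); linear `ι_{c,j} : ℚ^{Y_c} → ℚ^{Y₀}` (`j ∈ J_c`) equivariant on `A_c`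
(`hιeq`) and injective on `A_c` (`hinj`), with images `ι_{c,j}(A_c)` INDEPENDENT (`hindep`, over `Σ c, J_c`) and
spanning `ℚ^{Y₀}` (`htop`) — so `|J_c| = m_c` is the multiplicity of `A_c` in `ℚ^{Y₀}`; a class `c₀` with
commutant `𝒟` of `A = A_{c₀}` (`h𝒟`, translate form), `0 ≠ a₀ ∈ A`, `δ = dim 𝒟·a₀`; the Hom-space
`𝓗 = Hom_G(ℚ^{Y₀}, A)` (`h𝓗`, file R1) and the fixed subspace `F` of `Stab(x₀)` in `ℚ^{Y_{c₀}}` (`hF`).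

* **`card_mul_finrank_map_applyₗ_eq_finrank_inf` — `|J_{c₀}|·δ_{c₀} = dim(A_{c₀} ⊓ F) = dim A_{c₀}^{Stab(x₀)}`**;
  `finrank_map_applyₗ_dvd_finrank_inf` (`δ ∣ dim A^H`), `card_eq_finrank_inf_div` (`m_{c₀} = dim A^H/δ`),
  `card_ne_zero_iff_inf_ne_bot` (`A_{c₀}` OCCURS in the slot iff `A^H ≠ 0`),
  `card_mul_finrank_map_applyₗ_eq_finrank_of_free` (REGULAR slot — the stabiliser acts trivially on `Y_{c₀}`:
  `m·δ = dim A`, «each irreducible occurs `dim A/δ` times in the regular representation»), and the class sum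
  **`card_eq_sum_finrank_inf_div_mul_finrank`: `|Y₀| = Σ_c (dim A_c^{H}/δ_c)·dim A_c`**.
Sequel R4 `CorCM/IrreducibleOddWeightsIsotypicFrobeniusRank`: the no-input versions over gen 76 E3 and the rank /
nondegeneracy formulas with `m_{i,c}·δ_c = dim A_c^{H_i}`.

## References

* [LangeRodriguez2022] H. Lange, R. E. Rodríguez, *Decomposition of Jacobians by Prym Varieties*, LNM 2310 (2022),
  §2.8 eq. (2.18) and Lemma 2.8.1.
* [Serre1977] J.-P. Serre, *Linear Representations of Finite Groups*, GTM 42, §2.6 (canonical decomposition),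
  §3.3 Lemma 1, §7.2 Thm. 13 (Frobenius reciprocity), §12.1–12.2 (representations over `ℚ`, Schur index).
* [CurtisReiner1962] C. W. Curtis, I. Reiner, *Representation Theory of Finite Groups and Associative Algebras*,
  §27 (27.3).
* [Lang2002] S. Lang, *Algebra*, 3rd ed., XVII §1–§3.
-/

set_option autoImplicit false

noncomputable section

open scoped BigOperators Classical

universe v vC uC uJ w

namespace Summit.HodgeConjecture.CorCM.IrrOdd

variable {G : Type w} [Group G] {Y₀ : Type v} [MulAction G Y₀]

/-! ### §3 The count: `m_{c₀}·δ_{c₀} = dim A_{c₀}^{Stab(x₀)}` -/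

section Count

variable [Fintype Y₀] {C : Type uC} [Fintype C] {Yc : C → Type vC} [∀ c, MulAction G (Yc c)]
  [∀ c, Fintype (Yc c)] {Ar : ∀ c, Submodule ℚ (Yc c → ℚ)} {JJ : C → Type uJ} [∀ c, Fintype (JJ c)]

/-- **FROBENIUS RECIPROCITY FOR THE MULTIPLICITY: `|J_{c₀}|·δ_{c₀} = dim(A_{c₀} ⊓ F) = dim A_{c₀}^{Stab(x₀)}`.**
For a TRANSITIVE finite slot `Y₀ ∋ x₀` decomposed as `ℚ^{Y₀} = ⊕_{c,j} ι_{c,j}(A_c)` over pairwise non-embeddable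
stable irreducible references (embeddings equivariant and injective on `A_c`, images independent and spanning), the
number `|J_{c₀}|` of summands of class `c₀` times `δ_{c₀} = dim 𝒟·a₀` (`𝒟` the commutant of `A_{c₀}`, any
`0 ≠ a₀ ∈ A_{c₀}`) is the dimension of the `Stab(x₀)`-invariants of `A_{c₀}` — the multiplicity of `A_{c₀}` in the
permutation module is `dim A_{c₀}^H / dim_ℚ End_G(A_{c₀})`. [cite: LangeRodriguez2022, §2.8 Lemma 2.8.1]
[cite: Serre1977, §7.2 Thm. 13] -/
theorem card_mul_finrank_map_applyₗ_eq_finrank_inf {c₀ : C}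
    {𝒟 : Submodule ℚ ((Yc c₀ → ℚ) →ₗ[ℚ] (Yc c₀ → ℚ))}
    (h𝒟 : ∀ L : (Yc c₀ → ℚ) →ₗ[ℚ] (Yc c₀ → ℚ), L ∈ 𝒟 ↔ (∀ a ∈ Ar c₀, L a ∈ Ar c₀) ∧
      ∀ (k : G) (a : Yc c₀ → ℚ), a ∈ Ar c₀ → L (fun y => a (k • y)) = fun y => L a (k • y))
    (hRst : ∀ c (k : G) (a : Yc c → ℚ), a ∈ Ar c → (fun y => a (k • y)) ∈ Ar c)
    (hRirr : ∀ c (W : Submodule ℚ (Yc c → ℚ)), W ≤ Ar c → W ≠ ⊥ →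
      (∀ (k : G) (f : Yc c → ℚ), f ∈ W → (fun y => f (k • y)) ∈ W) → W = Ar c)
    (hsep : ∀ c c' (L : (Yc c → ℚ) →ₗ[ℚ] (Yc c' → ℚ)), c ≠ c' → Ar c ≠ ⊥ → (∀ a ∈ Ar c, L a ∈ Ar c') →
      (∀ a ∈ Ar c, L a = 0 → a = 0) →
      (∀ (k : G) (a : Yc c → ℚ), a ∈ Ar c → L (fun y => a (k • y)) = fun y => L a (k • y)) → False)
    (ι : ∀ c, JJ c → ((Yc c → ℚ) →ₗ[ℚ] (Y₀ → ℚ)))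
    (hιeq : ∀ c (j : JJ c) (k : G) (a : Yc c → ℚ), a ∈ Ar c →
      ι c j (fun y => a (k • y)) = fun y => ι c j a (k • y))
    (hinj : ∀ (j : JJ c₀) (a : Yc c₀ → ℚ), a ∈ Ar c₀ → ι c₀ j a = 0 → a = 0)
    (hindep : iSupIndep fun q : (Σ c, JJ c) => (Ar q.1).map (ι q.1 q.2))
    (htop : (⨆ c, ⨆ j, (Ar c).map (ι c j)) = ⊤)
    {a₀ : Yc c₀ → ℚ} (ha₀ : a₀ ∈ Ar c₀) (h0 : a₀ ≠ 0)
    {x₀ : Y₀} (htr : ∀ x : Y₀, ∃ g : G, g • x₀ = x) {F : Submodule ℚ (Yc c₀ → ℚ)}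
    (hF : ∀ f : Yc c₀ → ℚ, f ∈ F ↔ ∀ k : G, k • x₀ = x₀ → (fun y => f (k • y)) = f) :
    Fintype.card (JJ c₀) * Module.finrank ℚ ↥(𝒟.map (LinearMap.applyₗ a₀)) =
      Module.finrank ℚ ↥(Ar c₀ ⊓ F) := by
  obtain ⟨𝓗, h𝓗⟩ := exists_homSpace (G := G) (Y₀ := Y₀) (Ar c₀)
  rw [← finrank_homSpace_eq_card_mul h𝓗 h𝒟 hRst hRirr hsep ι hιeq hinj hindep htop ha₀ h0,
    finrank_homSpace_eq h𝓗 hF (hRst c₀) htr]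

/-- **`δ_{c₀} ∣ dim A_{c₀}^{Stab(x₀)}`.** [cite: LangeRodriguez2022, §2.8 Lemma 2.8.1] -/
theorem finrank_map_applyₗ_dvd_finrank_inf {c₀ : C}
    {𝒟 : Submodule ℚ ((Yc c₀ → ℚ) →ₗ[ℚ] (Yc c₀ → ℚ))}
    (h𝒟 : ∀ L : (Yc c₀ → ℚ) →ₗ[ℚ] (Yc c₀ → ℚ), L ∈ 𝒟 ↔ (∀ a ∈ Ar c₀, L a ∈ Ar c₀) ∧
      ∀ (k : G) (a : Yc c₀ → ℚ), a ∈ Ar c₀ → L (fun y => a (k • y)) = fun y => L a (k • y))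
    (hRst : ∀ c (k : G) (a : Yc c → ℚ), a ∈ Ar c → (fun y => a (k • y)) ∈ Ar c)
    (hRirr : ∀ c (W : Submodule ℚ (Yc c → ℚ)), W ≤ Ar c → W ≠ ⊥ →
      (∀ (k : G) (f : Yc c → ℚ), f ∈ W → (fun y => f (k • y)) ∈ W) → W = Ar c)
    (hsep : ∀ c c' (L : (Yc c → ℚ) →ₗ[ℚ] (Yc c' → ℚ)), c ≠ c' → Ar c ≠ ⊥ → (∀ a ∈ Ar c, L a ∈ Ar c') →
      (∀ a ∈ Ar c, L a = 0 → a = 0) →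
      (∀ (k : G) (a : Yc c → ℚ), a ∈ Ar c → L (fun y => a (k • y)) = fun y => L a (k • y)) → False)
    (ι : ∀ c, JJ c → ((Yc c → ℚ) →ₗ[ℚ] (Y₀ → ℚ)))
    (hιeq : ∀ c (j : JJ c) (k : G) (a : Yc c → ℚ), a ∈ Ar c →
      ι c j (fun y => a (k • y)) = fun y => ι c j a (k • y))
    (hinj : ∀ (j : JJ c₀) (a : Yc c₀ → ℚ), a ∈ Ar c₀ → ι c₀ j a = 0 → a = 0)
    (hindep : iSupIndep fun q : (Σ c, JJ c) => (Ar q.1).map (ι q.1 q.2))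
    (htop : (⨆ c, ⨆ j, (Ar c).map (ι c j)) = ⊤)
    {a₀ : Yc c₀ → ℚ} (ha₀ : a₀ ∈ Ar c₀) (h0 : a₀ ≠ 0)
    {x₀ : Y₀} (htr : ∀ x : Y₀, ∃ g : G, g • x₀ = x) {F : Submodule ℚ (Yc c₀ → ℚ)}
    (hF : ∀ f : Yc c₀ → ℚ, f ∈ F ↔ ∀ k : G, k • x₀ = x₀ → (fun y => f (k • y)) = f) :
    Module.finrank ℚ ↥(𝒟.map (LinearMap.applyₗ a₀)) ∣ Module.finrank ℚ ↥(Ar c₀ ⊓ F) :=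
  Dvd.intro_left _ (card_mul_finrank_map_applyₗ_eq_finrank_inf h𝒟 hRst hRirr hsep ι hιeq hinj hindep htop ha₀
    h0 htr hF)

omit [Fintype C] in
/-- `δ > 0`: the D-line of a non-zero `a₀` contains `a₀`. [folklore] -/
theorem finrank_map_applyₗ_pos {c₀ : C} {𝒟 : Submodule ℚ ((Yc c₀ → ℚ) →ₗ[ℚ] (Yc c₀ → ℚ))}
    (h𝒟 : ∀ L : (Yc c₀ → ℚ) →ₗ[ℚ] (Yc c₀ → ℚ), L ∈ 𝒟 ↔ (∀ a ∈ Ar c₀, L a ∈ Ar c₀) ∧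
      ∀ (k : G) (a : Yc c₀ → ℚ), a ∈ Ar c₀ → L (fun y => a (k • y)) = fun y => L a (k • y))
    {a₀ : Yc c₀ → ℚ} (h0 : a₀ ≠ 0) : 0 < Module.finrank ℚ ↥(𝒟.map (LinearMap.applyₗ a₀)) := by
  refine Module.finrank_pos_iff_exists_ne_zero.2 ⟨⟨a₀, ?_⟩, fun h1 => h0 (congrArg Subtype.val h1)⟩
  exact Submodule.mem_map.2 ⟨LinearMap.id, (h𝒟 _).2 ⟨fun a ha => ha, fun k a _ => rfl⟩, rfl⟩

/-- **THE MULTIPLICITY IS COMPUTABLE: `|J_{c₀}| = dim A_{c₀}^{Stab(x₀)} / δ_{c₀}`.**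
[cite: LangeRodriguez2022, §2.8 Lemma 2.8.1] [cite: Serre1977, §7.2 Thm. 13] -/
theorem card_eq_finrank_inf_div {c₀ : C}
    {𝒟 : Submodule ℚ ((Yc c₀ → ℚ) →ₗ[ℚ] (Yc c₀ → ℚ))}
    (h𝒟 : ∀ L : (Yc c₀ → ℚ) →ₗ[ℚ] (Yc c₀ → ℚ), L ∈ 𝒟 ↔ (∀ a ∈ Ar c₀, L a ∈ Ar c₀) ∧
      ∀ (k : G) (a : Yc c₀ → ℚ), a ∈ Ar c₀ → L (fun y => a (k • y)) = fun y => L a (k • y))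
    (hRst : ∀ c (k : G) (a : Yc c → ℚ), a ∈ Ar c → (fun y => a (k • y)) ∈ Ar c)
    (hRirr : ∀ c (W : Submodule ℚ (Yc c → ℚ)), W ≤ Ar c → W ≠ ⊥ →
      (∀ (k : G) (f : Yc c → ℚ), f ∈ W → (fun y => f (k • y)) ∈ W) → W = Ar c)
    (hsep : ∀ c c' (L : (Yc c → ℚ) →ₗ[ℚ] (Yc c' → ℚ)), c ≠ c' → Ar c ≠ ⊥ → (∀ a ∈ Ar c, L a ∈ Ar c') →
      (∀ a ∈ Ar c, L a = 0 → a = 0) →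
      (∀ (k : G) (a : Yc c → ℚ), a ∈ Ar c → L (fun y => a (k • y)) = fun y => L a (k • y)) → False)
    (ι : ∀ c, JJ c → ((Yc c → ℚ) →ₗ[ℚ] (Y₀ → ℚ)))
    (hιeq : ∀ c (j : JJ c) (k : G) (a : Yc c → ℚ), a ∈ Ar c →
      ι c j (fun y => a (k • y)) = fun y => ι c j a (k • y))
    (hinj : ∀ (j : JJ c₀) (a : Yc c₀ → ℚ), a ∈ Ar c₀ → ι c₀ j a = 0 → a = 0)
    (hindep : iSupIndep fun q : (Σ c, JJ c) => (Ar q.1).map (ι q.1 q.2))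
    (htop : (⨆ c, ⨆ j, (Ar c).map (ι c j)) = ⊤)
    {a₀ : Yc c₀ → ℚ} (ha₀ : a₀ ∈ Ar c₀) (h0 : a₀ ≠ 0)
    {x₀ : Y₀} (htr : ∀ x : Y₀, ∃ g : G, g • x₀ = x) {F : Submodule ℚ (Yc c₀ → ℚ)}
    (hF : ∀ f : Yc c₀ → ℚ, f ∈ F ↔ ∀ k : G, k • x₀ = x₀ → (fun y => f (k • y)) = f) :
    Fintype.card (JJ c₀) =
      Module.finrank ℚ ↥(Ar c₀ ⊓ F) / Module.finrank ℚ ↥(𝒟.map (LinearMap.applyₗ a₀)) := by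
  rw [← card_mul_finrank_map_applyₗ_eq_finrank_inf h𝒟 hRst hRirr hsep ι hιeq hinj hindep htop ha₀ h0 htr hF,
    Nat.mul_div_cancel _ (finrank_map_applyₗ_pos h𝒟 h0)]

/-- **`A_{c₀}` OCCURS IN THE SLOT IFF IT HAS NON-ZERO `Stab(x₀)`-INVARIANTS**: `|J_{c₀}| ≠ 0 ⟺ A_{c₀} ⊓ F ≠ 0`.
[cite: LangeRodriguez2022, §2.8 eq. (2.18)] [cite: Serre1977, §7.2 Thm. 13] -/
theorem card_ne_zero_iff_inf_ne_bot {c₀ : C}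
    {𝒟 : Submodule ℚ ((Yc c₀ → ℚ) →ₗ[ℚ] (Yc c₀ → ℚ))}
    (h𝒟 : ∀ L : (Yc c₀ → ℚ) →ₗ[ℚ] (Yc c₀ → ℚ), L ∈ 𝒟 ↔ (∀ a ∈ Ar c₀, L a ∈ Ar c₀) ∧
      ∀ (k : G) (a : Yc c₀ → ℚ), a ∈ Ar c₀ → L (fun y => a (k • y)) = fun y => L a (k • y))
    (hRst : ∀ c (k : G) (a : Yc c → ℚ), a ∈ Ar c → (fun y => a (k • y)) ∈ Ar c)
    (hRirr : ∀ c (W : Submodule ℚ (Yc c → ℚ)), W ≤ Ar c → W ≠ ⊥ →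
      (∀ (k : G) (f : Yc c → ℚ), f ∈ W → (fun y => f (k • y)) ∈ W) → W = Ar c)
    (hsep : ∀ c c' (L : (Yc c → ℚ) →ₗ[ℚ] (Yc c' → ℚ)), c ≠ c' → Ar c ≠ ⊥ → (∀ a ∈ Ar c, L a ∈ Ar c') →
      (∀ a ∈ Ar c, L a = 0 → a = 0) →
      (∀ (k : G) (a : Yc c → ℚ), a ∈ Ar c → L (fun y => a (k • y)) = fun y => L a (k • y)) → False)
    (ι : ∀ c, JJ c → ((Yc c → ℚ) →ₗ[ℚ] (Y₀ → ℚ)))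
    (hιeq : ∀ c (j : JJ c) (k : G) (a : Yc c → ℚ), a ∈ Ar c →
      ι c j (fun y => a (k • y)) = fun y => ι c j a (k • y))
    (hinj : ∀ (j : JJ c₀) (a : Yc c₀ → ℚ), a ∈ Ar c₀ → ι c₀ j a = 0 → a = 0)
    (hindep : iSupIndep fun q : (Σ c, JJ c) => (Ar q.1).map (ι q.1 q.2))
    (htop : (⨆ c, ⨆ j, (Ar c).map (ι c j)) = ⊤)
    {a₀ : Yc c₀ → ℚ} (ha₀ : a₀ ∈ Ar c₀) (h0 : a₀ ≠ 0)
    {x₀ : Y₀} (htr : ∀ x : Y₀, ∃ g : G, g • x₀ = x) {F : Submodule ℚ (Yc c₀ → ℚ)}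
    (hF : ∀ f : Yc c₀ → ℚ, f ∈ F ↔ ∀ k : G, k • x₀ = x₀ → (fun y => f (k • y)) = f) :
    Fintype.card (JJ c₀) ≠ 0 ↔ Ar c₀ ⊓ F ≠ ⊥ := by
  have h := card_mul_finrank_map_applyₗ_eq_finrank_inf h𝒟 hRst hRirr hsep ι hιeq hinj hindep htop ha₀ h0 htr hF
  have hδ := finrank_map_applyₗ_pos h𝒟 h0
  rw [Ne, Ne, ← Submodule.finrank_eq_zero, ← h, Nat.mul_eq_zero, not_or]
  exact ⟨fun h1 => ⟨h1, Nat.pos_iff_ne_zero.1 hδ⟩, fun h1 => h1.1⟩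

/-- **THE REGULAR CASE: if the stabiliser of `x₀` acts trivially on `Y_{c₀}` then `|J_{c₀}|·δ_{c₀} = dim A_{c₀}`**
(e.g. `G` finite acting on `Y₀ = Y_{c₀} = G` by translation: each irreducible `A` occurs `dim A/δ` times in the
regular representation `ℚ[G]`). [cite: Serre1977, §12.1 and §2.6] [cite: LangeRodriguez2022, §2.8 (2.21)–(2.23)] -/
theorem card_mul_finrank_map_applyₗ_eq_finrank_of_free {c₀ : C}
    {𝒟 : Submodule ℚ ((Yc c₀ → ℚ) →ₗ[ℚ] (Yc c₀ → ℚ))}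
    (h𝒟 : ∀ L : (Yc c₀ → ℚ) →ₗ[ℚ] (Yc c₀ → ℚ), L ∈ 𝒟 ↔ (∀ a ∈ Ar c₀, L a ∈ Ar c₀) ∧
      ∀ (k : G) (a : Yc c₀ → ℚ), a ∈ Ar c₀ → L (fun y => a (k • y)) = fun y => L a (k • y))
    (hRst : ∀ c (k : G) (a : Yc c → ℚ), a ∈ Ar c → (fun y => a (k • y)) ∈ Ar c)
    (hRirr : ∀ c (W : Submodule ℚ (Yc c → ℚ)), W ≤ Ar c → W ≠ ⊥ →
      (∀ (k : G) (f : Yc c → ℚ), f ∈ W → (fun y => f (k • y)) ∈ W) → W = Ar c)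
    (hsep : ∀ c c' (L : (Yc c → ℚ) →ₗ[ℚ] (Yc c' → ℚ)), c ≠ c' → Ar c ≠ ⊥ → (∀ a ∈ Ar c, L a ∈ Ar c') →
      (∀ a ∈ Ar c, L a = 0 → a = 0) →
      (∀ (k : G) (a : Yc c → ℚ), a ∈ Ar c → L (fun y => a (k • y)) = fun y => L a (k • y)) → False)
    (ι : ∀ c, JJ c → ((Yc c → ℚ) →ₗ[ℚ] (Y₀ → ℚ)))
    (hιeq : ∀ c (j : JJ c) (k : G) (a : Yc c → ℚ), a ∈ Ar c →
      ι c j (fun y => a (k • y)) = fun y => ι c j a (k • y))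
    (hinj : ∀ (j : JJ c₀) (a : Yc c₀ → ℚ), a ∈ Ar c₀ → ι c₀ j a = 0 → a = 0)
    (hindep : iSupIndep fun q : (Σ c, JJ c) => (Ar q.1).map (ι q.1 q.2))
    (htop : (⨆ c, ⨆ j, (Ar c).map (ι c j)) = ⊤)
    {a₀ : Yc c₀ → ℚ} (ha₀ : a₀ ∈ Ar c₀) (h0 : a₀ ≠ 0)
    {x₀ : Y₀} (htr : ∀ x : Y₀, ∃ g : G, g • x₀ = x)
    (hfree : ∀ k : G, k • x₀ = x₀ → ∀ y : Yc c₀, k • y = y) :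
    Fintype.card (JJ c₀) * Module.finrank ℚ ↥(𝒟.map (LinearMap.applyₗ a₀)) = Module.finrank ℚ (Ar c₀) := by
  obtain ⟨F, hF⟩ := exists_fixedSubmodule (G := G) (Y := Yc c₀) x₀
  have hF' : F = ⊤ := by
    rw [eq_top_iff]
    intro f _
    exact (hF f).2 fun k hk => funext fun y => by rw [hfree k hk y]
  rw [card_mul_finrank_map_applyₗ_eq_finrank_inf h𝒟 hRst hRirr hsep ι hιeq hinj hindep htop ha₀ h0 htr hF, hF',
    inf_top_eq]

/-- **THE PERMUTATION MODULE OF A TRANSITIVE SLOT, CLASS BY CLASS: `|Y₀| = Σ_c (dim A_c^{Stab(x₀)}/δ_c)·dim A_c`**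
(gen 76 E5 `|Y₀| = Σ_c |J_c|·dim A_c` with every `|J_c|` computed by Frobenius reciprocity).
[cite: LangeRodriguez2022, §2.8 Lemma 2.8.1] [cite: Serre1977, §2.6 and §7.2 Thm. 13] -/
theorem card_eq_sum_finrank_inf_div_mul_finrank
    {𝒟 : ∀ c, Submodule ℚ ((Yc c → ℚ) →ₗ[ℚ] (Yc c → ℚ))}
    (h𝒟 : ∀ c (L : (Yc c → ℚ) →ₗ[ℚ] (Yc c → ℚ)), L ∈ 𝒟 c ↔ (∀ a ∈ Ar c, L a ∈ Ar c) ∧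
      ∀ (k : G) (a : Yc c → ℚ), a ∈ Ar c → L (fun y => a (k • y)) = fun y => L a (k • y))
    (hRst : ∀ c (k : G) (a : Yc c → ℚ), a ∈ Ar c → (fun y => a (k • y)) ∈ Ar c)
    (hRirr : ∀ c (W : Submodule ℚ (Yc c → ℚ)), W ≤ Ar c → W ≠ ⊥ →
      (∀ (k : G) (f : Yc c → ℚ), f ∈ W → (fun y => f (k • y)) ∈ W) → W = Ar c)
    (hsep : ∀ c c' (L : (Yc c → ℚ) →ₗ[ℚ] (Yc c' → ℚ)), c ≠ c' → Ar c ≠ ⊥ → (∀ a ∈ Ar c, L a ∈ Ar c') →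
      (∀ a ∈ Ar c, L a = 0 → a = 0) →
      (∀ (k : G) (a : Yc c → ℚ), a ∈ Ar c → L (fun y => a (k • y)) = fun y => L a (k • y)) → False)
    (ι : ∀ c, JJ c → ((Yc c → ℚ) →ₗ[ℚ] (Y₀ → ℚ)))
    (hιeq : ∀ c (j : JJ c) (k : G) (a : Yc c → ℚ), a ∈ Ar c →
      ι c j (fun y => a (k • y)) = fun y => ι c j a (k • y))
    (hinj : ∀ c (j : JJ c) (a : Yc c → ℚ), a ∈ Ar c → ι c j a = 0 → a = 0)
    (hindep : iSupIndep fun q : (Σ c, JJ c) => (Ar q.1).map (ι q.1 q.2))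
    (htop : (⨆ c, ⨆ j, (Ar c).map (ι c j)) = ⊤)
    {a₀ : ∀ c, Yc c → ℚ} (ha₀ : ∀ c, a₀ c ∈ Ar c) (h0 : ∀ c, a₀ c ≠ 0)
    {x₀ : Y₀} (htr : ∀ x : Y₀, ∃ g : G, g • x₀ = x) {F : ∀ c, Submodule ℚ (Yc c → ℚ)}
    (hF : ∀ c (f : Yc c → ℚ), f ∈ F c ↔ ∀ k : G, k • x₀ = x₀ → (fun y => f (k • y)) = f) :
    Fintype.card Y₀ = ∑ c, Module.finrank ℚ ↥(Ar c ⊓ F c) /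
      Module.finrank ℚ ↥((𝒟 c).map (LinearMap.applyₗ (a₀ c))) * Module.finrank ℚ (Ar c) := by
  rw [card_eq_sum_card_mul_finrank ι hinj hindep htop]
  refine Finset.sum_congr rfl fun c _ => ?_
  rw [card_eq_finrank_inf_div (h𝒟 c) hRst hRirr hsep ι hιeq (hinj c) hindep htop (ha₀ c) (h0 c) htr (hF c)]

end Count

end Summit.HodgeConjecture.CorCM.IrrOdd

end
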